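import Literature.AlgebraicGeometry.HodgeTheory.FermatSymmetricEigenlinesHodgeType
import Literature.AlgebraicGeometry.HodgeTheory.HodgeIndexTheoremLefschetzForms
import Literature.AlgebraicGeometry.HodgeTheory.HypersurfaceLefschetzUpper
import HarnessLib

/-!
# Hodge types of the flat `Γ_W`-pieces of the Dwork sextic along an equivariant transport to the
# Fermat point: the `(3,1)`/`(1,3)`-parts vanish by the Hodge–Riemann bilinear relations

Family `hodge`, layer `Literature/AlgebraicGeometry/HodgeTheory`; theorems only (no definition, no
named fact; D-0026). Sequel to `FermatSymmetricEigenlinesHodgeType` (at the Fermat sextic fourfold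
`X⁴₆` the `Γ_W`-pieces of Katz's flat types `(1,2,3,3,4,5)`, `(1,1,2,4,5,5)`, `(1,1,3,3,5,5)` are pure
`(2,2)`) and `DworkSexticSingletonRankOfTransport` (an equivariant injective linear
`T : H⁴(X_ψ(ℂ); ℂ) → H⁴(X⁴₆(ℂ); ℂ)` carries `Γ_W`-eigenspaces into `Γ_W`-eigenspaces). Written for
crux K2 `FlatClassesSpannedByReflectionInvariants` (stmt-HodgeConjecture-20241) of route
`HodgeConjecture/DworkReflectionQuotients`.

THE ARGUMENT (Katz 2009, proof of Lemma 3.1(2), "the Hodge numbers of the eigensheaves are those at the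
Fermat point", with the variation of Hodge structure replaced by topology + Hodge–Riemann). Let
`ψ⁶ ≠ 1`, `χ ≠ 1` a character of `Γ_W` whose eigenspace `V_χ(X⁴₆)` is pure `(2,2)`, and let
`T : H⁴(X_ψ) → H⁴(X⁴₆)` be injective, `Γ_W`-equivariant, commuting with complex conjugation,
multiplicative into `H⁸` through a companion `T'` (`T'(x ⌣ y) = Tx ⌣ Ty`) and fixing the restricted
ambient classes (`T ∘ ι_ψ^* = ι_0^*` on `H⁴(ℙ⁵)`) — the properties of parallel transport along the
Dwork line (Voisin II §3.1.2: `γ_*` is a ring isomorphism defined over `ℚ`, and classes restricted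
from the total space are flat). Then **`V_χ(X_ψ)` has no `(3,1)`-part**
(`DworkSextic.eq_zero_of_mem_eigenspace_of_hodgePQ_three_one_of_transport`): for
`x ∈ V_χ(X_ψ) ∩ H^{3,1}`, `x ≠ 0`, the class is primitive (the hyperplane class is `Γ_W`-invariant and
`H⁶(X_ψ) = ι^*H⁶(ℙ⁵)` carries the trivial character — Lefschetz, `surjective_map_of_upper`), so
Voisin I Thm. 6.32 gives `x ⌣ x̄ = −c·Ω_ψ`, `c > 0` (`KaehlerRationalDatum.cupProduct_lefschetzPowTo_
lefschetzPowTo_conjClass_of_primitive`, sign `(−1)³`); `Tx ∈ V_χ(X⁴₆)` is non-zero, primitive and of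
type `(2,2)`, so `Tx ⌣ conj(Tx) = +c₀·Ω₀`; and `T'` carries the first identity to the second up to the
POSITIVE factor by which `T'` relates the squares of the Kähler classes (`(ι^*θ)² ⌣ (ι^*θ)²` is a
positive multiple of `Ω` on both sides, Thm. 6.32 with sign `(−1)⁰`, and `T` maps one to a
`|c₁|⁴`-multiple of the other) — a contradiction of signs. The `(1,3)`-part follows by conjugation,
and purity `(2,2)` of `V_χ(X_ψ)` follows as soon as its `(4,0)`-part vanishes — that packaging, and
its specialisation to Katz's flat types `j = 0, 2, 3` (Fermat input:
`DworkSextic.fermat_flatTypes_gammaW_eigenspace_pullback_mem_hodgePQ_two_two`) down to the shape of crux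
K2, is the sequel file `DworkSexticFlatPiecesPurityOfTransport`.

So for these `810` of the route's `1170` flat classes, Katz's Lemma 3.1(2) at `ψ⁶ ≠ 1` is reduced to
(a) the equivariant transport along the Dwork line (a construction: the `Γ_W`-action on the family of
`Γ_W`-invariant sextics, `defn-MonomialSupportedHypersurfaceFamily`) and (b) the vanishing of the
`(4,0)`-parts of the flat pieces of `X_ψ`, i.e. `H^{4,0}(X_ψ) = ℂ·Res(Ω/F_ψ)` carries the trivial
character of `Γ_W` (`p_g = 1` for the Calabi–Yau sextic; Griffiths' residue theorem at pole order ONE)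
— instead of Griffiths' description of `F³H⁴` at pole order two. Nothing here uses or asserts a named
fact.

* §1 (general smooth hypersurface `X_F ⊂ ℙⁿ⁺¹`): Lefschetz surjectivity for the concrete embedding
  `hypersurfaceι F` below and above the middle degree, triviality of the diagonal symmetries there,
  vanishing of non-trivial eigenspaces there, and primitivity of middle-degree eigenclasses of a
  non-trivial character for any invariant class `κ ∈ H²`.
* §2 the sextic: the theorems above (homogeneity `Lʲ_{c κ} = cʲ Lʲ_κ` is the tree's `lefschetzPowTo_smul`).

## References

* [Katz2009] N. M. Katz, Another look at the Dwork family, Progr. Math. 270 (2009), Lemma 3.1 (proof).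
* [VoisinHodgeI2002] C. Voisin, Hodge Theory and Complex Algebraic Geometry I (2002), §6.2.3 Def. 6.24,
  §6.3.2 Lemma 6.31 and Thm. 6.32, §7.1.2.
* [VoisinHodgeII2003] C. Voisin, Hodge Theory and Complex Algebraic Geometry II (2003), §1.2.3
  Cor. 1.24–1.25 (Lefschetz for hypersurfaces), §3.1.2 (local systems and transport).
* [SerreLinearRepresentations1977] J.-P. Serre, Linear Representations of Finite Groups, §2.6.
-/

noncomputable section

open CategoryTheory MvPolynomial Finset
open scoped BigOperators

namespace Literature.AlgebraicGeometry.HodgeTheory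

open Literature.AlgebraicGeometry.Motives Literature.AlgebraicTopology.SingularHomology
open Literature.Geometry.Kaehler

/-! ### §1 Smooth hypersurfaces: Lefschetz off the middle degree and the diagonal symmetries -/

section Hypersurface

variable {n d : ℕ} {F : MvPolynomial (Fin (n + 2)) ℂ}

/-- **Lefschetz below the middle degree for the concrete embedding** `ι : X_F ↪ ℙⁿ⁺¹`:
`ι^* : Hᵏ(ℙⁿ⁺¹(ℂ); ℂ) → Hᵏ(X_F(ℂ); ℂ)` is onto for `k < n` (`surjective_map_of_lt` fed with
`range_hypersurfaceι`). [cite: VoisinHodgeII2003, §1.2.2 Thm. 1.23 and §1.2.3 Cor. 1.24] -/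
theorem surjective_map_hypersurfaceι_of_lt (hY : IsSmoothHypersurface n d (SmoothHypersurface.hypersurface F))
    (hF : F.IsHomogeneous d) (hirr : Irreducible F) {k : ℕ} (hk : k < n) :
    Function.Surjective (complexBetti.map (SmoothHypersurface.hypersurfaceι F) k) :=
  surjective_map_of_lt hY hF hirr (SmoothHypersurface.hypersurfaceι F)
    (SmoothHypersurface.range_hypersurfaceι F) hk

/-- **Lefschetz above the middle degree for the concrete embedding**: `ι^*` is onto `H²ᵖ(X_F(ℂ); ℂ)`
for `n < 2p < 2n` (`surjective_map_of_upper`). [cite: VoisinHodgeII2003, §1.2.3 Cor. 1.25] -/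
theorem surjective_map_hypersurfaceι_of_upper (hY : IsSmoothHypersurface n d (SmoothHypersurface.hypersurface F))
    (hF : F.IsHomogeneous d) (hirr : Irreducible F) (hJ : SmoothHypersurface.IsNonsingularForm ℂ F)
    (hd : 0 < d) {p : ℕ} (hnp : n < 2 * p) (hpn : p < n) :
    Function.Surjective (complexBetti.map (SmoothHypersurface.hypersurfaceι F) (2 * p)) :=
  surjective_map_of_upper hY hF hirr (SmoothHypersurface.isReduced_hypersurface F hF hJ hd)
    (SmoothHypersurface.hypersurfaceι F) (SmoothHypersurface.range_hypersurfaceι F) hnp hpn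

/-- **The diagonal symmetries act trivially where `ι^*` is onto**: `g_a^* x = x` for every class in
the image of `ι^* : Hᵏ(ℙⁿ⁺¹(ℂ); ℂ) → Hᵏ(X_F(ℂ); ℂ)` (`g_a` covers a linear map of `ℙⁿ⁺¹`, which acts
trivially on `H*(ℙⁿ⁺¹(ℂ))`: `map_diagonalMap_map_hypersurfaceι`). [cite: VoisinHodgeII2003, §1.2.3 Cor. 1.25] -/
theorem map_diagonalMap_eq_self_of_surjective {a : Fin (n + 2) → ℂˣ} (ha : a ∈ diagonalStabilizer F)
    {k : ℕ} (hsurj : Function.Surjective (complexBetti.map (SmoothHypersurface.hypersurfaceι F) k))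
    (x : complexBetti (SmoothHypersurface.hypersurface F) k) :
    singularCohomology.map ℂ ℂ (diagonalMap F ha) k x = x := by
  obtain ⟨η, rfl⟩ := hsurj x
  exact map_diagonalMap_map_hypersurfaceι F ha k η

/-- **A non-trivial character does not occur where `ι^*` is onto**: for `G ≤ diagonalStabilizer F`,
`χ ≠ 1` and `ι^*` onto `Hᵏ(X_F(ℂ); ℂ)`, the `χ`-eigenspace of `Hᵏ` is zero (`g_b^* x = χ(b) x = x` with
`χ(b) ≠ 1`). [cite: SerreLinearRepresentations1977, §2.6 Thm. 8] -/
theorem eq_zero_of_mem_eigenspace_of_surjective {G : Subgroup (Fin (n + 2) → ℂˣ)}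
    (hG : G ≤ diagonalStabilizer F) {χ : G →* ℂˣ} (hχ : χ ≠ 1) {k : ℕ}
    (hsurj : Function.Surjective (complexBetti.map (SmoothHypersurface.hypersurfaceι F) k))
    {x : complexBetti (SmoothHypersurface.hypersurface F) k} (hx : x ∈ diagonalCharacterEigenspace F G χ k) :
    x = 0 := by
  obtain ⟨b, hb⟩ : ∃ b, χ b ≠ 1 := not_forall.mp fun h : ∀ b, χ b = 1 => hχ (MonoidHom.ext h)
  rw [mem_diagonalCharacterEigenspace_iff_diagonalMap hG] at hx
  have h := hx b
  rw [map_diagonalMap_eq_self_of_surjective (hG b.2) hsurj x] at h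
  have h' : (((χ b : ℂˣ) : ℂ) - 1) • x = 0 := by rw [sub_smul, one_smul, ← h, sub_self]
  refine (smul_eq_zero.mp h').resolve_left (sub_ne_zero.mpr fun h1 => hb (Units.val_injective ?_))
  rw [h1, Units.val_one]

/-- **Middle-degree eigenclasses of a non-trivial character are primitive** for every `G`-invariant
class `κ ∈ H²(X_F(ℂ); ℂ)` (e.g. a Kähler class restricted from `ℙⁿ⁺¹`): `κ ⌣ x ∈ Hⁿ⁺²` is again a
`χ`-eigenclass (`g_a^*` is multiplicative), and `Hⁿ⁺²(X_F) = ι^*Hⁿ⁺²(ℙⁿ⁺¹)` carries only the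
trivial character. [cite: VoisinHodgeI2002, §6.2.3 Def. 6.24] [cite: VoisinHodgeII2003, §1.2.3 Cor. 1.25] -/
theorem mem_primitiveClasses_of_mem_eigenspace {G : Subgroup (Fin (n + 2) → ℂˣ)}
    (hG : G ≤ diagonalStabilizer F) {χ : G →* ℂˣ} (hχ : χ ≠ 1)
    {κ : complexBetti (SmoothHypersurface.hypersurface F) 2}
    (hκ : ∀ a : G, singularCohomology.map ℂ ℂ (diagonalMap F (hG a.2)) 2 κ = κ)
    (hsurj : Function.Surjective (complexBetti.map (SmoothHypersurface.hypersurfaceι F) (n + 2)))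
    {x : complexBetti (SmoothHypersurface.hypersurface F) n} (hx : x ∈ diagonalCharacterEigenspace F G χ n) :
    x ∈ primitiveClasses κ n n := by
  refine ⟨fun h => absurd h (lt_irrefl n), fun r m h hr => ?_⟩
  obtain rfl : r = 1 := by omega
  obtain rfl : m = n + 2 := by omega
  rw [lefschetzPowTo_succ_apply κ 0 n n (n + 2) rfl h (by omega), lefschetzPowTo_zero_apply,
    lefschetzOperator_apply]
  refine eq_zero_of_mem_eigenspace_of_surjective hG hχ hsurj ?_
  rw [mem_diagonalCharacterEigenspace_iff_diagonalMap hG] at hx ⊢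
  intro a
  rw [cupProduct_map, hκ a, hx a, map_smul]

/-- In a space of dimension `≤ 1` spanned by `v ≠ 0`, every vector is a multiple of `v`. [folklore] -/
private theorem exists_smul_eq_of_finrank_le_one {V : Type*} [AddCommGroup V] [Module ℂ V]
    [FiniteDimensional ℂ V] (h : Module.finrank ℂ V ≤ 1) {v : V} (hv : v ≠ 0) (w : V) :
    ∃ c : ℂ, c • v = w := by
  have h1 : Module.finrank ℂ V = 1 :=
    le_antisymm h (Module.finrank_pos_iff_exists_ne_zero.mpr ⟨v, hv⟩)
  exact (finrank_eq_one_iff_of_nonzero' v hv).mp h1 w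

/-- **`H²(X_F(ℂ); ℂ)` is at most a line** for `n ≥ 3` (`ι^*` onto from the line `H²(ℙⁿ⁺¹(ℂ); ℂ)`).
[cite: VoisinHodgeII2003, §1.2.3 Cor. 1.24] -/
theorem finrank_complexBetti_two_le_one (hY : IsSmoothHypersurface n d (SmoothHypersurface.hypersurface F))
    (hF : F.IsHomogeneous d) (hirr : Irreducible F) (hn : 2 < n) :
    Module.finrank ℂ (complexBetti (SmoothHypersurface.hypersurface F) 2) ≤ 1 := by
  have h := finrank_complexBetti_le_of_surjective (isSmoothProjective_projectiveSpace_holds ℂ (n + 1))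
    (SmoothHypersurface.hypersurfaceι F) 2 (surjective_map_hypersurfaceι_of_lt hY hF hirr hn)
  rwa [show (2 : ℕ) = 2 * 1 from rfl, finrank_complexBetti_projectiveSpace_two_mul (n + 1) (by omega)] at h

end Hypersurface

/-! ### §2 The Dwork sextic: `(3,1)`-parts of flat pieces vanish along an equivariant transport -/

namespace DworkSextic

/-- The Dwork form `F_ψ` is irreducible. [cite: Katz2009, Lemma 2.1] -/
theorem irreducible_form (ψ : ℂ) : Irreducible (form ψ) := by
  simpa [MvPolynomial.map_id] using irreducible_map_form ψ ℂ

/-- The Fermat sextic form in six variables is irreducible and nonsingular (Eisenstein at `(ζ,1,0,…)`,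
`ζ⁶ = −1`; Jacobian criterion). [cite: Hartshorne1977, I Ex. 5.5 and II Example 8.20.2] -/
theorem irreducible_isNonsingularForm_fermat :
    Irreducible (fermatPolynomial ℂ 4 6) ∧ SmoothHypersurface.IsNonsingularForm ℂ (fermatPolynomial ℂ 4 6) := by
  obtain ⟨ζ, hζ⟩ : ∃ ζ : ℂ, ζ ^ 6 = -1 := IsAlgClosed.exists_pow_nat_eq (-1) (by norm_num)
  refine ⟨?_, SmoothHypersurface.isNonsingularForm_sum_X_pow (by norm_num)⟩
  exact SmoothHypersurface.irreducible_sum_X_pow (by norm_num) (by norm_num) (by norm_num) ζ hζ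

variable {ψ : ℂ}

/-- `ι_ψ^*` is onto `H²(X_ψ)` and `H⁶(X_ψ)` (`ψ⁶ ≠ 1`), and onto `H²(X⁴₆)`, `H⁶(X⁴₆)` (Lefschetz).
[cite: VoisinHodgeII2003, §1.2.3 Cor. 1.24–1.25] -/
theorem surjective_map_hypersurfaceι (hψ : ψ ^ 6 ≠ 1) :
    Function.Surjective (complexBetti.map (SmoothHypersurface.hypersurfaceι (form ψ)) 2) ∧
    Function.Surjective (complexBetti.map (SmoothHypersurface.hypersurfaceι (form ψ)) (4 + 2)) ∧
    Function.Surjective (complexBetti.map (SmoothHypersurface.hypersurfaceι (fermatPolynomial ℂ 4 6)) 2) ∧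
    Function.Surjective (complexBetti.map (SmoothHypersurface.hypersurfaceι (fermatPolynomial ℂ 4 6)) (4 + 2)) := by
  obtain ⟨hirr, hJ⟩ := irreducible_isNonsingularForm_fermat
  refine ⟨surjective_map_hypersurfaceι_of_lt (isSmoothHypersurface_fibre hψ) (isHomogeneous_form ψ)
      (irreducible_form ψ) (by norm_num), ?_,
    surjective_map_hypersurfaceι_of_lt (isSmoothHypersurface_fermatHypersurface (by norm_num) (by norm_num))
      (isHomogeneous_fermatPolynomial 4 6) hirr (by norm_num), ?_⟩
  · have h := surjective_map_hypersurfaceι_of_upper (isSmoothHypersurface_fibre hψ) (isHomogeneous_form ψ)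
      (irreducible_form ψ) (isNonsingularForm_form hψ) (by norm_num) (p := 3) (by norm_num) (by norm_num)
    exact h
  · have h := surjective_map_hypersurfaceι_of_upper
      (isSmoothHypersurface_fermatHypersurface (by norm_num) (by norm_num)) (isHomogeneous_fermatPolynomial 4 6)
      hirr hJ (by norm_num) (p := 3) (by norm_num) (by norm_num)
    exact h

/-- **The `(3,1)`-part of a flat piece vanishes along an equivariant transport to the Fermat point.**
Let `ψ⁶ ≠ 1`, `A`, `A₀` Hodge models of `X_ψ` and `X⁴₆`, `χ ≠ 1` a character of `Γ_W` whose eigenspace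
in `H⁴(X⁴₆(ℂ); ℂ)` is of type `(2,2)` in `A₀`, and `T : H⁴(X_ψ(ℂ); ℂ) → H⁴(X⁴₆(ℂ); ℂ)` `ℂ`-linear,
injective, `Γ_W`-equivariant, commuting with conjugation, with a companion `T'` on `H⁸` such that
`T'(x ⌣ y) = Tx ⌣ Ty`, and fixing the restricted ambient classes, `T(ι_ψ^* θ) = ι_0^* θ`
(`θ ∈ H⁴(ℙ⁵(ℂ); ℂ)`). Then every `x ∈ V_χ(X_ψ)` with `A^* x ∈ H^{3,1}_A` vanishes. (Hodge–Riemann,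
Voisin I Thm. 6.32: `x ⌣ x̄ < 0` for `x` primitive of type `(3,1)`, `Tx ⌣ conj Tx > 0` for `Tx` primitive
of type `(2,2)`, and `T'` preserves the sign of the square of the Kähler class.)
[cite: VoisinHodgeI2002, §6.3.2 Thm. 6.32] [cite: Katz2009, Lemma 3.1 (proof)]
[cite: VoisinHodgeII2003, §3.1.2] -/
theorem eq_zero_of_mem_eigenspace_of_hodgePQ_three_one_of_transport (hψ : ψ ^ 6 ≠ 1)
    (A : HodgeModel 4 (fibre ψ)) (A₀ : HodgeModel 4 (fermatHypersurface 4 6))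
    {χ : gammaW →* ℂˣ} (hχ : χ ≠ 1)
    (hχF : ∀ c ∈ diagonalCharacterEigenspace (fermatPolynomial ℂ 4 6) gammaW χ (2 * 2),
      A₀.pullback (2 * 2) c ∈ A₀.hodgePQ (2 * 2) 2 2)
    (T : complexBetti (fibre ψ) (2 * 2) →ₗ[ℂ] complexBetti (fermatHypersurface 4 6) (2 * 2))
    (hTinj : Function.Injective T)
    (hTeq : ∀ (a : gammaW) (c : complexBetti (fibre ψ) (2 * 2)),
      T (singularCohomology.map ℂ ℂ (diagonalMap (form ψ) (gammaW_le_diagonalStabilizer ψ a.2)) (2 * 2) c) =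
        singularCohomology.map ℂ ℂ
          (diagonalMap (fermatPolynomial ℂ 4 6) (gammaW_le_diagonalStabilizer_fermat a.2)) (2 * 2) (T c))
    (hTconj : ∀ c, T (conjClass _ (2 * 2) c) = conjClass _ (2 * 2) (T c))
    (T' : complexBetti (fibre ψ) (2 * 4) →ₗ[ℂ] complexBetti (fermatHypersurface 4 6) (2 * 4))
    (hT' : ∀ x y : complexBetti (fibre ψ) (2 * 2),
      T' (cupProduct (by norm_num : 2 * 2 + 2 * 2 = 2 * 4) x y) =
        cupProduct (by norm_num : 2 * 2 + 2 * 2 = 2 * 4) (T x) (T y))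
    (hTamb : ∀ θ : complexBetti (projectiveSpace (4 + 1) ℂ) (2 * 2),
      T (complexBetti.map (SmoothHypersurface.hypersurfaceι (form ψ)) (2 * 2) θ) =
        complexBetti.map (SmoothHypersurface.hypersurfaceι (fermatPolynomial ℂ 4 6)) (2 * 2) θ)
    {x : complexBetti (fibre ψ) (2 * 2)} (hx : x ∈ diagonalCharacterEigenspace (form ψ) gammaW χ (2 * 2))
    (hxA : A.pullback (2 * 2) x ∈ A.hodgePQ (2 * 2) 3 1) : x = 0 := by
  by_contra hx0
  have hXψ : IsSmoothProjective 4 (fibre ψ) := isSmoothProjective_fibre hψ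
  have hX0 : IsSmoothProjective 4 (fermatHypersurface 4 6) :=
    isSmoothProjective_fermatHypersurface (by norm_num) (by norm_num)
  have hGψ := gammaW_le_diagonalStabilizer ψ
  have hG0 := gammaW_le_diagonalStabilizer_fermat
  obtain ⟨h2ψ, h6ψ, h20, h60⟩ := surjective_map_hypersurfaceι hψ
  obtain ⟨D⟩ := nonempty_kaehlerRationalDatum hXψ
  obtain ⟨D₀⟩ := nonempty_kaehlerRationalDatum hX0
  haveI := finite_complexBetti hX0 2
  -- degree bookkeeping
  have hdeg : 2 * 2 + 2 * 2 = 2 * 4 := by norm_num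
  have hm : 2 * 2 + 2 * 0 = 2 * 2 := by norm_num
  have h02 : 0 + 2 * 2 = 2 * 2 := by norm_num
  -- the Kähler classes are restricted ambient classes, hence `Γ_W`-invariant
  obtain ⟨θ₁, hθ₁⟩ := h2ψ D.Hη
  have hκψ : ∀ a : gammaW, singularCohomology.map ℂ ℂ (diagonalMap (form ψ) (hGψ a.2)) 2 D.Hη = D.Hη :=
    fun a => map_diagonalMap_eq_self_of_surjective (hGψ a.2) h2ψ D.Hη
  have hκ0 : ∀ a : gammaW,
      singularCohomology.map ℂ ℂ (diagonalMap (fermatPolynomial ℂ 4 6) (hG0 a.2)) 2 D₀.Hη = D₀.Hη :=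
    fun a => map_diagonalMap_eq_self_of_surjective (hG0 a.2) h20 D₀.Hη
  -- Step 1: `x` is primitive of type `(3,1)`: `x ⌣ x̄ = -c Ω_ψ`, `c > 0`
  have hprim : x ∈ primitiveClasses D.Hη 4 (2 * 2) :=
    mem_primitiveClasses_of_mem_eigenspace hGψ hχ hκψ h6ψ hx
  obtain ⟨c, hc, hcup⟩ := D.cupProduct_lefschetzPowTo_lefschetzPowTo_conjClass_of_primitive hXψ
    (k := 2 * 2) (r := 0) (m := 2 * 2) (even_two_mul 2) (by norm_num) hm hdeg (a := 2 * 2) (t := 0) hm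
    (s := 3) (t₁ := 1) (by norm_num) (u := x) ⟨A, hxA⟩ hprim hx0
  simp only [lefschetzPowTo_zero_eq_id, LinearMap.id_apply] at hcup
  -- Step 2: `y = T x ∈ V_χ(X⁴₆)` is non-zero, primitive, of type `(2,2)`: `y ⌣ ȳ = +c₀ Ω₀`
  set y := T x with hy_def
  have hy : y ∈ diagonalCharacterEigenspace (fermatPolynomial ℂ 4 6) gammaW χ (2 * 2) :=
    map_mem_fermatEigenspace_of_equivariant hTeq hx
  have hy0 : y ≠ 0 := fun h => hx0 (hTinj (by rw [map_zero]; exact h))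
  have hyprim : y ∈ primitiveClasses D₀.Hη 4 (2 * 2) :=
    mem_primitiveClasses_of_mem_eigenspace hG0 hχ hκ0 h60 hy
  obtain ⟨c₀, hc₀, hcup₀⟩ := D₀.cupProduct_lefschetzPowTo_lefschetzPowTo_conjClass_of_primitive hX0
    (k := 2 * 2) (r := 0) (m := 2 * 2) (even_two_mul 2) (by norm_num) hm hdeg (a := 2 * 2) (t := 0) hm
    (s := 2) (t₁ := 2) (by norm_num) (u := y) ⟨A₀, hχF y hy⟩ hyprim hy0
  simp only [lefschetzPowTo_zero_eq_id, LinearMap.id_apply] at hcup₀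
  -- Step 3: transport of Step 1: `((-1)^3 c) • T' Ω_ψ = c₀ • Ω₀`
  have hE1 : ((-1 : ℂ) ^ 3 * (c : ℂ)) • T' D.topClass = ((-1 : ℂ) ^ 2 * (c₀ : ℂ)) • D₀.topClass := by
    rw [← map_smul, ← hcup, hT', hTconj, ← hy_def, hcup₀]
  -- Step 4: the squares of the Kähler classes. `Q = L²_{Hη} 1`, `Q ⌣ Q̄ = κ Ω`, `κ > 0`, on both sides
  haveI := pathConnectedSpace_complexPoints_of_isSmoothProjective hXψ
  haveI := pathConnectedSpace_complexPoints_of_isSmoothProjective hX0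
  have hone : (singularCohomology.one ℂ (ComplexPoints (fibre ψ))) ≠ 0 := fun h0 => by
    have h1 := singularCohomologyZeroEquiv_one (R := ℂ) (X := ComplexPoints (fibre ψ))
    rw [h0, map_zero] at h1
    exact zero_ne_one h1
  have hone₀ : (singularCohomology.one ℂ (ComplexPoints (fermatHypersurface 4 6))) ≠ 0 := fun h0 => by
    have h1 := singularCohomologyZeroEquiv_one (R := ℂ) (X := ComplexPoints (fermatHypersurface 4 6))
    rw [h0, map_zero] at h1
    exact zero_ne_one h1
  have hone_prim : singularCohomology.one ℂ (ComplexPoints (fibre ψ)) ∈ primitiveClasses D.Hη 4 0 := by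
    refine ⟨fun h => absurd h (by norm_num), fun r m h hr => ?_⟩
    haveI := subsingleton_of_lt hXψ ℂ m (by omega)
    exact Subsingleton.elim _ _
  have hone_prim₀ : singularCohomology.one ℂ (ComplexPoints (fermatHypersurface 4 6)) ∈
      primitiveClasses D₀.Hη 4 0 := by
    refine ⟨fun h => absurd h (by norm_num), fun r m h hr => ?_⟩
    haveI := subsingleton_of_lt hX0 ℂ m (by omega)
    exact Subsingleton.elim _ _
  obtain ⟨κ, hκ, hQ⟩ := D.cupProduct_lefschetzPowTo_lefschetzPowTo_conjClass_of_primitive hXψ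
    (k := 2 * 2) (r := 0) (m := 2 * 2) (even_two_mul 2) (by norm_num) hm hdeg (a := 0) (t := 2) h02
    (s := 0) (t₁ := 0) (by norm_num) (isOfHodgeType_zero_zero_of_degree_zero hXψ _) hone_prim hone
  obtain ⟨κ₀, hκ₀, hQ₀⟩ := D₀.cupProduct_lefschetzPowTo_lefschetzPowTo_conjClass_of_primitive hX0
    (k := 2 * 2) (r := 0) (m := 2 * 2) (even_two_mul 2) (by norm_num) hm hdeg (a := 0) (t := 2) h02
    (s := 0) (t₁ := 0) (by norm_num) (isOfHodgeType_zero_zero_of_degree_zero hX0 _) hone_prim₀ hone₀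
  simp only [lefschetzPowTo_zero_eq_id, LinearMap.id_apply] at hQ hQ₀
  -- `T` carries `Q_ψ = ι^*(L²_{θ₁} 1)` to `L²_{ι_0^*θ₁} 1 = c₁² Q₀`
  set Qψ := lefschetzPowTo D.Hη 2 0 (2 * 2) h02 (singularCohomology.one ℂ (ComplexPoints (fibre ψ)))
    with hQψ_def
  set Q₀ := lefschetzPowTo D₀.Hη 2 0 (2 * 2) h02
    (singularCohomology.one ℂ (ComplexPoints (fermatHypersurface 4 6))) with hQ₀_def
  have hQψ_amb : Qψ = complexBetti.map (SmoothHypersurface.hypersurfaceι (form ψ)) (2 * 2)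
      (lefschetzPowTo θ₁ 2 0 (2 * 2) h02 (singularCohomology.one ℂ (ComplexPoints (projectiveSpace (4 + 1) ℂ)))) := by
    rw [map_lefschetzPowTo, hθ₁]
    change Qψ = lefschetzPowTo D.Hη 2 0 (2 * 2) h02 (singularCohomology.map ℂ ℂ _ 0 (singularCohomology.one ℂ _))
    rw [singularCohomology.map_one]
  -- `ι_0^* θ₁ = c₁ • D₀.Hη` (`H²(X⁴₆)` is the line spanned by the Kähler class)
  have hHη₀ : D₀.Hη ≠ 0 := by
    intro h0
    apply D₀.topClass_ne_zero hX0
    have hQ0 : Q₀ = 0 := by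
      rw [hQ₀_def, h0, show (0 : complexBetti (fermatHypersurface 4 6) 2) = (0 : ℂ) • D₀.Hη by rw [zero_smul],
        lefschetzPowTo_smul, zero_pow two_ne_zero, zero_smul]
    rw [hQ0, map_zero, LinearMap.zero_apply] at hQ₀
    have h1 : ((-1 : ℂ) ^ 0 * (κ₀ : ℂ)) ≠ 0 := by
      rw [pow_zero, one_mul]; exact_mod_cast hκ₀.ne'
    exact (smul_eq_zero.mp hQ₀.symm).resolve_left h1
  obtain ⟨hirrF, -⟩ := irreducible_isNonsingularForm_fermat
  obtain ⟨c₁, hc₁⟩ := exists_smul_eq_of_finrank_le_one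
    (finrank_complexBetti_two_le_one (isSmoothHypersurface_fermatHypersurface (by norm_num) (by norm_num))
      (isHomogeneous_fermatPolynomial 4 6) hirrF (by norm_num)) hHη₀
    (complexBetti.map (SmoothHypersurface.hypersurfaceι (fermatPolynomial ℂ 4 6)) 2 θ₁)
  have hTQ : T Qψ = (c₁ ^ 2) • Q₀ := by
    rw [hQψ_amb, hTamb, map_lefschetzPowTo, ← hc₁, lefschetzPowTo_smul]
    change c₁ ^ 2 • lefschetzPowTo D₀.Hη 2 0 (2 * 2) h02
      (singularCohomology.map ℂ ℂ _ 0 (singularCohomology.one ℂ _)) = _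
    rw [singularCohomology.map_one]
  -- Step 5: transport of `Q_ψ ⌣ Q̄_ψ = κ Ω_ψ`: `κ • T' Ω_ψ = (c₁² conj(c₁)² κ₀) • Ω₀`
  have hE2 : ((-1 : ℂ) ^ 0 * (κ : ℂ)) • T' D.topClass =
      (c₁ ^ 2 * (starRingEnd ℂ c₁) ^ 2 * ((-1 : ℂ) ^ 0 * (κ₀ : ℂ))) • D₀.topClass := by
    rw [← map_smul, ← hQ, hT', hTconj, hTQ, conjClass_smul, map_smul, map_smul, LinearMap.smul_apply, hQ₀,
      smul_smul, smul_smul, map_pow]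
    congr 1
    ring
  -- Step 6: compare the two identities
  have hc0 : (c : ℂ) ≠ 0 := by exact_mod_cast hc.ne'
  have hT'Ω : T' D.topClass = (-((c₀ / c : ℝ) : ℂ)) • D₀.topClass := by
    have h3 : ((-1 : ℂ) ^ 3 * (c : ℂ)) = -(c : ℂ) := by ring
    have h2 : ((-1 : ℂ) ^ 2 * (c₀ : ℂ)) = (c₀ : ℂ) := by ring
    rw [h3, h2] at hE1
    have h := congrArg (fun v => (-(c : ℂ))⁻¹ • v) hE1
    simp only [smul_smul] at h
    rw [inv_mul_cancel₀ (neg_ne_zero.mpr hc0), one_smul] at h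
    rw [h]
    congr 1
    push_cast
    field_simp
  rw [hT'Ω, smul_smul, pow_zero, one_mul, one_mul] at hE2
  have hnormSq : c₁ ^ 2 * (starRingEnd ℂ c₁) ^ 2 = ((Complex.normSq c₁ ^ 2 : ℝ) : ℂ) := by
    rw [← mul_pow, Complex.mul_conj]; push_cast; ring
  rw [hnormSq, ← sub_eq_zero, ← sub_smul] at hE2
  have hcoef : (κ : ℂ) * -((c₀ / c : ℝ) : ℂ) - ((Complex.normSq c₁ ^ 2 : ℝ) : ℂ) * (κ₀ : ℂ) ≠ 0 := by
    have hreal : (κ : ℂ) * -((c₀ / c : ℝ) : ℂ) - ((Complex.normSq c₁ ^ 2 : ℝ) : ℂ) * (κ₀ : ℂ) =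
        ((-(κ * (c₀ / c)) - Complex.normSq c₁ ^ 2 * κ₀ : ℝ) : ℂ) := by push_cast; ring
    rw [hreal, Ne, Complex.ofReal_eq_zero]
    have h1 : 0 < κ * (c₀ / c) := mul_pos hκ (div_pos hc₀ hc)
    have h2 : 0 ≤ Complex.normSq c₁ ^ 2 * κ₀ := mul_nonneg (sq_nonneg _) hκ₀.le
    linarith
  exact D₀.topClass_ne_zero hX0 ((smul_eq_zero.mp hE2).resolve_left hcoef)

end DworkSextic

end Literature.AlgebraicGeometry.HodgeTheory

end
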